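import Literature.Analysis.SegalBargmann.HermiteOscillatorTorus
import Mathlib.Analysis.Normed.Group.Tannery
import HarnessLib

/-!
# Strong continuity of Hermite multiplier families on `𝒮(ℝⁿ)`; the oscillator torus is strongly continuous

Topic `Analysis/SegalBargmann`; namespace `Literature.Analysis.SegalBargmann`.  Continuation of
`Literature.Analysis.SegalBargmann.HermiteMultiplierOperators` (`T_m f = Σ_β m_β c_β(f) h_β` is a continuous operator
on `𝒮(ℝ^σ, ℂ)` for every multiplier of polynomial growth `‖m_β‖ ≤ M (|β|+1)^a`) and `HermiteOscillatorTorus`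
(`U(θ) = e^{iθ·N} = T_{e^{iθ·β}}`).  Here the dependence ON THE MULTIPLIER is controlled:

* §1 the rapidly-decreasing weights `Σ_β (|β|+1)^μ ‖c_β(f)‖` are bounded by finitely many Schwartz seminorms of `f`
  (`exists_tsum_degree_pow_mul_norm_hermiteCoeff_le_sup_seminorm`), hence the **uniform operator bound**
  `p_{k,l}(T_m f) ≤ M · C_{k,l,a} · (s.sup p)(f)` with `s`, `C` depending only on `(k, l, a)` — the family
  `{T_m : ‖m_β‖ ≤ M (|β|+1)^a}` is EQUICONTINUOUS on `𝒮(ℝ^σ, ℂ)` (`exists_seminorm_hermiteMultiplierCLM_le_sup_seminorm`);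
* §2 the difference estimate `p_{k,l}(T_m f − T_{m'} f) ≤ C Σ_β (|β|+1)^r ‖(m_β − m'_β) c_β(f)‖`
  (`seminorm_hermiteMultiplierCLM_sub_le`) and, by dominated convergence over the Hermite expansion (Tannery), the
  **strong continuity of multiplier families**: if `t ↦ m_t(β)` is continuous for every `β` and `‖m_t(β)‖ ≤ M (|β|+1)^a`
  uniformly in `t`, then `t ↦ T_{m_t} f` is continuous INTO `𝒮(ℝ^σ, ℂ)` for every `f`
  (`tendsto_hermiteMultiplierCLM_apply` along any filter, `continuous_hermiteMultiplierCLM_apply`), and jointly `(t, f) ↦ T_{m_t} f` is continuous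
  (`continuous_hermiteMultiplierCLM_uncurry`);
* §3 **the oscillator torus `θ ↦ e^{iθ·N} f` is continuous into `𝒮(ℝ^σ, ℂ)`** for every Schwartz `f`
  (`continuous_torusOpCLM_apply`), jointly in `(θ, f)` (`continuous_torusOpCLM_uncurry`): the compact torus of the
  metaplectic representation acts STRONGLY CONTINUOUSLY on its space of smooth vectors `𝒮(ℝ^σ)` with the Schwartz
  topology (Folland 1989 §1.7, Thm 1.83, for the eigenbasis; the 𝒮-continuity is proved here).

Everything is proved from Mathlib and the imported tree files; no cited fact is used as a hypothesis. [folklore]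
-/

set_option autoImplicit false

noncomputable section

open Complex SchwartzMap MeasureTheory Filter Topology
open scoped BigOperators Real NNReal

namespace Literature.Analysis.SegalBargmann

variable {σ : Type*} [Fintype σ] [DecidableEq σ]

/-! ## §1  Weighted coefficient sums and the uniform operator bound -/

section UniformBound

/-- **`Σ_β (|β|+1)^μ ‖c_β(f)‖ ≤ C · (s.sup p)(f)`**: the rapidly-decreasing weights of the Hermite coefficients are
controlled by finitely many Schwartz seminorms (`tsum_degree_pow_mul_norm_hermiteCoeff_le` and the `L²` bounds
`exists_sqrt_integral_norm_sq_le_sup_seminorm` for `1` and `N^j`). [cite: Folland1989, §1.7] -/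
theorem exists_tsum_degree_pow_mul_norm_hermiteCoeff_le_sup_seminorm (μ : ℕ) :
    ∃ (s : Finset (ℕ × ℕ)) (C : ℝ), 0 ≤ C ∧ ∀ f : 𝓢(EuclideanSpace ℝ σ, ℂ),
      ∑' β : σ →₀ ℕ, ((β.degree : ℝ) + 1) ^ μ * ‖hermiteCoeff β f‖ ≤
        C * (s.sup (schwartzSeminormFamily ℂ (EuclideanSpace ℝ σ) ℂ)) f := by
  set n : ℕ := Fintype.card σ with hn
  set j : ℕ := μ + (n + 2) with hj
  obtain ⟨s₁, C₁, hC₁0, h₁⟩ :=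
    exists_sqrt_integral_norm_sq_le_sup_seminorm (ContinuousLinearMap.id ℂ (𝓢(EuclideanSpace ℝ σ, ℂ)))
  obtain ⟨s₂, C₂, hC₂0, h₂⟩ :=
    exists_sqrt_integral_norm_sq_le_sup_seminorm ((numberOpCLM : 𝓢(EuclideanSpace ℝ σ, ℂ) →L[ℂ] _) ^ j)
  set W : ℝ := ∑' β : σ →₀ ℕ, (((β.degree : ℝ) + 1) ^ (n + 2))⁻¹ with hWdef
  have hW0 : 0 ≤ W := tsum_nonneg fun β => by positivity
  set S := (s₁ ∪ s₂).sup (schwartzSeminormFamily ℂ (EuclideanSpace ℝ σ) ℂ) with hS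
  have hS₁ : ∀ f, (s₁.sup (schwartzSeminormFamily ℂ (EuclideanSpace ℝ σ) ℂ)) f ≤ S f := fun f =>
    Seminorm.le_def.mp (Finset.sup_mono Finset.subset_union_left) f
  have hS₂ : ∀ f, (s₂.sup (schwartzSeminormFamily ℂ (EuclideanSpace ℝ σ) ℂ)) f ≤ S f := fun f =>
    Seminorm.le_def.mp (Finset.sup_mono Finset.subset_union_right) f
  refine ⟨s₁ ∪ s₂, 2 ^ j * (C₁ + C₂) * W, by positivity, fun f => ?_⟩
  have e3 := tsum_degree_pow_mul_norm_hermiteCoeff_le μ f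
  rw [← hn, ← hj, ← hWdef] at e3
  have e4 : Real.sqrt (∫ x : EuclideanSpace ℝ σ, ‖f x‖ ^ 2) ≤ C₁ * S f := by
    have h := h₁ f
    simp only [ContinuousLinearMap.coe_id', id_eq] at h
    exact h.trans (mul_le_mul_of_nonneg_left (hS₁ f) hC₁0)
  have e5 : Real.sqrt (∫ x : EuclideanSpace ℝ σ, ‖(numberOpCLM ^ j) f x‖ ^ 2) ≤ C₂ * S f :=
    (h₂ f).trans (mul_le_mul_of_nonneg_left (hS₂ f) hC₂0)
  calc ∑' β : σ →₀ ℕ, ((β.degree : ℝ) + 1) ^ μ * ‖hermiteCoeff β f‖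
      ≤ 2 ^ j * (Real.sqrt (∫ x : EuclideanSpace ℝ σ, ‖f x‖ ^ 2) +
          Real.sqrt (∫ x : EuclideanSpace ℝ σ, ‖(numberOpCLM ^ j) f x‖ ^ 2)) * W := e3
    _ ≤ 2 ^ j * (C₁ * S f + C₂ * S f) * W := by gcongr
    _ = 2 ^ j * (C₁ + C₂) * W * S f := by ring

/-- **Uniform operator bound / equicontinuity of the multipliers of a given growth**: for every `(k, l, a)` there are
finitely many Schwartz seminorms `s` and `C ≥ 0` with `p_{k,l}(T_m f) ≤ M · C · (s.sup p)(f)` for EVERY multiplier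
with `‖m_β‖ ≤ M (|β|+1)^a` and every `f`. [cite: Folland1989, §1.7] -/
theorem exists_seminorm_hermiteMultiplierCLM_le_sup_seminorm (k l a : ℕ) :
    ∃ (s : Finset (ℕ × ℕ)) (C : ℝ), 0 ≤ C ∧ ∀ (m : (σ →₀ ℕ) → ℂ) (M : ℝ) (hm : IsPolyBounded m a M)
      (f : 𝓢(EuclideanSpace ℝ σ, ℂ)),
      SchwartzMap.seminorm ℂ k l (hermiteMultiplierCLM m hm f) ≤
        M * C * (s.sup (schwartzSeminormFamily ℂ (EuclideanSpace ℝ σ) ℂ)) f := by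
  obtain ⟨C₀, hC₀0, hC₀⟩ := exists_seminorm_hermiteSchwartz_herm_le (σ := σ) k l
  obtain ⟨s, C₁, hC₁0, hC₁⟩ :=
    exists_tsum_degree_pow_mul_norm_hermiteCoeff_le_sup_seminorm (σ := σ) (k + l + Fintype.card σ + 1 + a)
  refine ⟨s, C₀ * C₁, mul_nonneg hC₀0 hC₁0, fun m M hm f => ?_⟩
  have hM := hm.nonneg
  have e1 := seminorm_le_of_hasSum hC₀0 hC₀ (hasSum_hermiteMultiplierCLM m hm f) (hm.summable f _)
  have e2 := hm.tsum_le f (k + l + Fintype.card σ + 1)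
  calc SchwartzMap.seminorm ℂ k l (hermiteMultiplierCLM m hm f)
      ≤ C₀ * ∑' β : σ →₀ ℕ, ((β.degree : ℝ) + 1) ^ (k + l + Fintype.card σ + 1) *
          ‖m β * hermiteCoeff β f‖ := e1
    _ ≤ C₀ * (M * ∑' β : σ →₀ ℕ, ((β.degree : ℝ) + 1) ^ (k + l + Fintype.card σ + 1 + a) *
          ‖hermiteCoeff β f‖) := by gcongr
    _ ≤ C₀ * (M * (C₁ * (s.sup (schwartzSeminormFamily ℂ (EuclideanSpace ℝ σ) ℂ)) f)) := by
        gcongr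
        exact hC₁ f
    _ = M * (C₀ * C₁) * (s.sup (schwartzSeminormFamily ℂ (EuclideanSpace ℝ σ) ℂ)) f := by ring

omit [DecidableEq σ] in
/-- A finite supremum of Schwartz seminorms is dominated by their sum. [folklore] -/
theorem finset_sup_schwartzSeminormFamily_apply_le_sum (s : Finset (ℕ × ℕ)) (f : 𝓢(EuclideanSpace ℝ σ, ℂ)) :
    (s.sup (schwartzSeminormFamily ℂ (EuclideanSpace ℝ σ) ℂ)) f ≤
      ∑ i ∈ s, schwartzSeminormFamily ℂ (EuclideanSpace ℝ σ) ℂ i f := by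
  classical
  induction s using Finset.induction_on with
  | empty => simp
  | @insert i s hi ih =>
    rw [Finset.sup_insert, Finset.sum_insert hi]
    refine (Seminorm.sup_apply _ _ _).le.trans (max_le ?_ ?_)
    · exact le_add_of_nonneg_right (Finset.sum_nonneg fun _ _ => apply_nonneg _ _)
    · exact (ih).trans (le_add_of_nonneg_left (apply_nonneg _ _))

end UniformBound

/-! ## §2  Difference estimate and strong continuity of multiplier families -/

section StrongContinuity

variable {m m' : (σ →₀ ℕ) → ℂ} {a : ℕ} {M M' : ℝ}

omit [Fintype σ] [DecidableEq σ] in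
/-- Differences of polynomially bounded multipliers are polynomially bounded. [folklore] -/
theorem IsPolyBounded.sub (hm : IsPolyBounded m a M) (hm' : IsPolyBounded m' a M') :
    IsPolyBounded (m - m') a (M + M') := fun β => by
  rw [Pi.sub_apply, add_mul]
  exact (norm_sub_le _ _).trans (add_le_add (hm β) (hm' β))

/-- The difference series: `Σ_β (m_β − m'_β) c_β(f) h_β = T_m f − T_{m'} f` in `𝒮(ℝ^σ)`. [folklore] -/
theorem hasSum_hermiteMultiplierCLM_sub (hm : IsPolyBounded m a M) (hm' : IsPolyBounded m' a M')
    (f : 𝓢(EuclideanSpace ℝ σ, ℂ)) :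
    HasSum (fun β : σ →₀ ℕ => ((m - m') β * hermiteCoeff β f) • hermiteSchwartz (herm β))
      (hermiteMultiplierCLM m hm f - hermiteMultiplierCLM m' hm' f) := by
  refine ((hasSum_hermiteMultiplierCLM m hm f).sub (hasSum_hermiteMultiplierCLM m' hm' f)).congr_fun fun β => ?_
  rw [Pi.sub_apply, sub_mul, sub_smul]

/-- **Difference estimate**: if `p_{k,l}(h_α) ≤ C (|α|+1)^μ` for all `α` (`C ≥ 0`), then
`p_{k,l}(T_m f − T_{m'} f) ≤ C Σ_β (|β|+1)^μ ‖(m_β − m'_β) c_β(f)‖`. [cite: Folland1989, §1.7] -/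
theorem seminorm_hermiteMultiplierCLM_sub_le {k l μ : ℕ} {C : ℝ} (hC0 : 0 ≤ C)
    (hC : ∀ α : σ →₀ ℕ, SchwartzMap.seminorm ℂ k l (hermiteSchwartz (herm α)) ≤ C * ((α.degree : ℝ) + 1) ^ μ)
    (hm : IsPolyBounded m a M) (hm' : IsPolyBounded m' a M') (f : 𝓢(EuclideanSpace ℝ σ, ℂ)) :
    SchwartzMap.seminorm ℂ k l (hermiteMultiplierCLM m hm f - hermiteMultiplierCLM m' hm' f) ≤
      C * ∑' β : σ →₀ ℕ, ((β.degree : ℝ) + 1) ^ μ * ‖(m β - m' β) * hermiteCoeff β f‖ :=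
  seminorm_le_of_hasSum hC0 hC (hasSum_hermiteMultiplierCLM_sub hm hm' f) ((hm.sub hm').summable f μ)

variable {ι : Type*} {l : Filter ι} {mi : ι → (σ →₀ ℕ) → ℂ} {m₀ : (σ →₀ ℕ) → ℂ}

/-- The weighted difference sums `Σ_β (|β|+1)^μ ‖(m_i(β) − m₀(β)) c_β(f)‖` tend to `0` along a filter whenever
`m_i(β) → m₀(β)` for every `β` and the family is uniformly of polynomial growth (Tannery's theorem: the terms are
dominated by `2M (|β|+1)^{μ+a} ‖c_β(f)‖`, summable). [folklore] -/
theorem tendsto_tsum_degree_pow_mul_norm_sub_mul_hermiteCoeff (hmi : ∀ i, IsPolyBounded (mi i) a M)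
    (hm₀ : IsPolyBounded m₀ a M) (hc : ∀ β : σ →₀ ℕ, Tendsto (fun i => mi i β) l (𝓝 (m₀ β)))
    (f : 𝓢(EuclideanSpace ℝ σ, ℂ)) (μ : ℕ) :
    Tendsto (fun i => ∑' β : σ →₀ ℕ, ((β.degree : ℝ) + 1) ^ μ * ‖(mi i β - m₀ β) * hermiteCoeff β f‖)
      l (𝓝 0) := by
  have hM : 0 ≤ M := hm₀.nonneg
  have hlim : Tendsto (fun i => ∑' β : σ →₀ ℕ, ((β.degree : ℝ) + 1) ^ μ * ‖(mi i β - m₀ β) * hermiteCoeff β f‖)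
      l (𝓝 (∑' β : σ →₀ ℕ, ((β.degree : ℝ) + 1) ^ μ * ‖(m₀ β - m₀ β) * hermiteCoeff β f‖)) := by
    refine tendsto_tsum_of_dominated_convergence
      (bound := fun β : σ →₀ ℕ => 2 * M * (((β.degree : ℝ) + 1) ^ (μ + a) * ‖hermiteCoeff β f‖))
      ((summable_degree_pow_mul_norm_hermiteCoeff (μ + a) f).mul_left (2 * M)) (fun β => ?_)
      (Eventually.of_forall fun i β => ?_)
    · exact (tendsto_const_nhds.mul (((hc β).sub tendsto_const_nhds).mul tendsto_const_nhds).norm)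
    · rw [Real.norm_of_nonneg (by positivity), norm_mul, pow_add]
      have h1 : ‖mi i β - m₀ β‖ ≤ 2 * M * ((β.degree : ℝ) + 1) ^ a := by
        refine (norm_sub_le _ _).trans ?_
        have := hmi i β
        have := hm₀ β
        linarith
      calc ((β.degree : ℝ) + 1) ^ μ * (‖mi i β - m₀ β‖ * ‖hermiteCoeff β f‖)
          ≤ ((β.degree : ℝ) + 1) ^ μ * ((2 * M * ((β.degree : ℝ) + 1) ^ a) * ‖hermiteCoeff β f‖) := by
            gcongr
        _ = 2 * M * (((β.degree : ℝ) + 1) ^ μ * ((β.degree : ℝ) + 1) ^ a * ‖hermiteCoeff β f‖) := by ring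
  simpa only [sub_self, zero_mul, norm_zero, mul_zero, tsum_zero] using hlim

/-- **Convergence of multiplier operators along a filter** (strong operator topology on `𝒮`): if `m_i(β) → m₀(β)`
for every `β` and `‖m_i(β)‖, ‖m₀(β)‖ ≤ M (|β|+1)^a`, then `T_{m_i} f → T_{m₀} f` in `𝒮(ℝ^σ, ℂ)` for every `f`.
[cite: Folland1989, §1.7] -/
theorem tendsto_hermiteMultiplierCLM_apply (hmi : ∀ i, IsPolyBounded (mi i) a M) (hm₀ : IsPolyBounded m₀ a M)
    (hc : ∀ β : σ →₀ ℕ, Tendsto (fun i => mi i β) l (𝓝 (m₀ β))) (f : 𝓢(EuclideanSpace ℝ σ, ℂ)) :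
    Tendsto (fun i => hermiteMultiplierCLM (mi i) (hmi i) f) l (𝓝 (hermiteMultiplierCLM m₀ hm₀ f)) := by
  have hW := schwartz_withSeminorms ℂ (EuclideanSpace ℝ σ) ℂ
  rw [hW.tendsto_nhds]
  rintro ⟨k, l'⟩ ε hε
  obtain ⟨C, hC0, hC⟩ := exists_seminorm_hermiteSchwartz_herm_le (σ := σ) k l'
  have hlim := (tendsto_tsum_degree_pow_mul_norm_sub_mul_hermiteCoeff hmi hm₀ hc f
    (k + l' + Fintype.card σ + 1)).const_mul C
  rw [mul_zero] at hlim
  filter_upwards [hlim.eventually (Iio_mem_nhds hε)] with i hi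
  exact (seminorm_hermiteMultiplierCLM_sub_le hC0 hC (hmi i) hm₀ f).trans_lt hi

variable {T : Type*} [TopologicalSpace T] {mt : T → (σ →₀ ℕ) → ℂ}

/-- **Strong continuity of multiplier families.**  Let `t ↦ m_t` be a family of multipliers with
`‖m_t(β)‖ ≤ M (|β|+1)^a` uniformly in `t` and `t ↦ m_t(β)` continuous for every `β`.  Then for every Schwartz `f`
the map `t ↦ T_{m_t} f` is continuous into `𝒮(ℝ^σ, ℂ)` (Schwartz topology). [cite: Folland1989, §1.7] -/
theorem continuous_hermiteMultiplierCLM_apply (hmt : ∀ t, IsPolyBounded (mt t) a M)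
    (hc : ∀ β : σ →₀ ℕ, Continuous fun t => mt t β) (f : 𝓢(EuclideanSpace ℝ σ, ℂ)) :
    Continuous fun t => hermiteMultiplierCLM (mt t) (hmt t) f :=
  continuous_iff_continuousAt.2 fun t₀ =>
    tendsto_hermiteMultiplierCLM_apply hmt (hmt t₀) (fun β => (hc β).tendsto t₀) f

/-- **Joint continuity** `(t, f) ↦ T_{m_t} f` on `T × 𝒮(ℝ^σ, ℂ)` (strong continuity plus equicontinuity).
[cite: Folland1989, §1.7] -/
theorem continuous_hermiteMultiplierCLM_uncurry (hmt : ∀ t, IsPolyBounded (mt t) a M)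
    (hc : ∀ β : σ →₀ ℕ, Continuous fun t => mt t β) :
    Continuous fun p : T × 𝓢(EuclideanSpace ℝ σ, ℂ) => hermiteMultiplierCLM (mt p.1) (hmt p.1) p.2 := by
  have hW := schwartz_withSeminorms ℂ (EuclideanSpace ℝ σ) ℂ
  refine continuous_iff_continuousAt.2 fun q => ?_
  obtain ⟨t₀, f₀⟩ := q
  rw [ContinuousAt, hW.tendsto_nhds]
  rintro ⟨k, l⟩ ε hε
  have hM : 0 ≤ M := (hmt t₀).nonneg
  obtain ⟨s, C, hC0, hsC⟩ := exists_seminorm_hermiteMultiplierCLM_le_sup_seminorm (σ := σ) k l a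
  -- the `f`-increment: `p(T_{m_t}(f - f₀)) ≤ M C S(f - f₀) ≤ M C Σ_{i∈s} p_i (f - f₀) → 0`
  have h1 : Tendsto (fun p : T × 𝓢(EuclideanSpace ℝ σ, ℂ) =>
      M * C * ∑ i ∈ s, schwartzSeminormFamily ℂ (EuclideanSpace ℝ σ) ℂ i (p.2 - f₀)) (𝓝 (t₀, f₀)) (𝓝 0) := by
    have hcont : Continuous fun p : T × 𝓢(EuclideanSpace ℝ σ, ℂ) =>
        M * C * ∑ i ∈ s, schwartzSeminormFamily ℂ (EuclideanSpace ℝ σ) ℂ i (p.2 - f₀) :=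
      continuous_const.mul (continuous_finsetSum s fun i _ =>
        (hW.continuous_seminorm i).comp (continuous_snd.sub continuous_const))
    simpa only [sub_self, map_zero, Finset.sum_const_zero, mul_zero] using hcont.tendsto (t₀, f₀)
  -- the `t`-increment at `f₀`
  obtain ⟨C', hC'0, hC'⟩ := exists_seminorm_hermiteSchwartz_herm_le (σ := σ) k l
  have h2 := ((tendsto_tsum_degree_pow_mul_norm_sub_mul_hermiteCoeff hmt (hmt t₀)
    (fun β => (hc β).tendsto t₀) f₀ (k + l + Fintype.card σ + 1)).const_mul C').comp
    (continuous_fst.tendsto (t₀, f₀))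
  rw [mul_zero] at h2
  have hε2 : 0 < ε / 2 := half_pos hε
  filter_upwards [h1.eventually (Iio_mem_nhds hε2), h2.eventually (Iio_mem_nhds hε2)] with p hp1 hp2
  obtain ⟨t, f⟩ := p
  simp only [Function.comp_apply] at hp1 hp2
  have hsplit : hermiteMultiplierCLM (mt t) (hmt t) f - hermiteMultiplierCLM (mt t₀) (hmt t₀) f₀ =
      hermiteMultiplierCLM (mt t) (hmt t) (f - f₀) +
        (hermiteMultiplierCLM (mt t) (hmt t) f₀ - hermiteMultiplierCLM (mt t₀) (hmt t₀) f₀) := by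
    rw [map_sub]; abel
  calc SchwartzMap.seminorm ℂ k l
        (hermiteMultiplierCLM (mt t) (hmt t) f - hermiteMultiplierCLM (mt t₀) (hmt t₀) f₀)
      ≤ SchwartzMap.seminorm ℂ k l (hermiteMultiplierCLM (mt t) (hmt t) (f - f₀)) +
          SchwartzMap.seminorm ℂ k l
            (hermiteMultiplierCLM (mt t) (hmt t) f₀ - hermiteMultiplierCLM (mt t₀) (hmt t₀) f₀) := by
        rw [hsplit]; exact map_add_le_add _ _ _
    _ < ε / 2 + ε / 2 := by
        refine add_lt_add (lt_of_le_of_lt ?_ hp1) (lt_of_le_of_lt ?_ hp2)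
        · exact (hsC (mt t) M (hmt t) (f - f₀)).trans (mul_le_mul_of_nonneg_left
            (finset_sup_schwartzSeminormFamily_apply_le_sum s (f - f₀)) (mul_nonneg hM hC0))
        · exact seminorm_hermiteMultiplierCLM_sub_le hC'0 hC' (hmt t) (hmt t₀) f₀
    _ = ε := add_halves ε

end StrongContinuity

/-! ## §3  The oscillator torus is strongly continuous on `𝒮(ℝ^σ)` -/

section Torus

omit [DecidableEq σ] in
/-- `θ ↦ e^{iθ·β}` is continuous. [folklore] -/
theorem continuous_torusPhase (β : σ →₀ ℕ) : Continuous fun θ : σ → ℝ => torusPhase θ β := by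
  unfold torusPhase
  refine Complex.continuous_exp.comp ((Complex.continuous_ofReal.comp ?_).mul continuous_const)
  exact continuous_finsetSum _ fun j _ => (continuous_apply j).mul continuous_const

/-- **Strong continuity of the oscillator torus on `𝒮(ℝ^σ, ℂ)`**: `θ ↦ e^{iθ·N} f` is continuous into the Schwartz
space for every Schwartz `f` (Folland 1989 §1.7, Thm 1.83: the Hermite functions diagonalise the oscillator group;
the continuity on all of `𝒮(ℝ^σ)` is proved here from the coefficient decay). [cite: Folland1989, §1.7] -/
theorem continuous_torusOpCLM_apply (f : 𝓢(EuclideanSpace ℝ σ, ℂ)) :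
    Continuous fun θ : σ → ℝ => torusOpCLM θ f :=
  continuous_hermiteMultiplierCLM_apply (fun θ => isPolyBounded_torusPhase θ) continuous_torusPhase f

/-- **Joint continuity** `(θ, f) ↦ e^{iθ·N} f` on `ℝ^σ × 𝒮(ℝ^σ, ℂ)`. [cite: Folland1989, §1.7] -/
theorem continuous_torusOpCLM_uncurry :
    Continuous fun p : (σ → ℝ) × 𝓢(EuclideanSpace ℝ σ, ℂ) => torusOpCLM p.1 p.2 :=
  continuous_hermiteMultiplierCLM_uncurry (fun θ => isPolyBounded_torusPhase θ) continuous_torusPhase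

/-- **Uniform bound for the torus**: `p_{k,l}(e^{iθ·N} f) ≤ C · (s.sup p)(f)` with `s`, `C` independent of `θ`
(equicontinuity of the compact torus on `𝒮`). [cite: Folland1989, §1.7] -/
theorem exists_seminorm_torusOpCLM_le_sup_seminorm (k l : ℕ) :
    ∃ (s : Finset (ℕ × ℕ)) (C : ℝ), 0 ≤ C ∧ ∀ (θ : σ → ℝ) (f : 𝓢(EuclideanSpace ℝ σ, ℂ)),
      SchwartzMap.seminorm ℂ k l (torusOpCLM θ f) ≤ C * (s.sup (schwartzSeminormFamily ℂ (EuclideanSpace ℝ σ) ℂ)) f := by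
  obtain ⟨s, C, hC0, h⟩ := exists_seminorm_hermiteMultiplierCLM_le_sup_seminorm (σ := σ) k l 0
  refine ⟨s, C, hC0, fun θ f => ?_⟩
  show SchwartzMap.seminorm ℂ k l (hermiteMultiplierCLM (torusPhase θ) (isPolyBounded_torusPhase θ) f) ≤ _
  simpa only [one_mul] using h (torusPhase θ) 1 (isPolyBounded_torusPhase θ) f

/-- At `θ → 0`: `e^{iθ·N} f → f` in `𝒮(ℝ^σ, ℂ)`. [folklore] -/
theorem tendsto_torusOpCLM_zero (f : 𝓢(EuclideanSpace ℝ σ, ℂ)) :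
    Tendsto (fun θ : σ → ℝ => torusOpCLM θ f) (𝓝 0) (𝓝 f) := by
  have h := (continuous_torusOpCLM_apply f).tendsto (0 : σ → ℝ)
  rwa [torusOpCLM_zero, ContinuousLinearMap.id_apply] at h

end Torus

end Literature.Analysis.SegalBargmann
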